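import Mathlib
import HarnessLib
import Literature.Analysis.FluidPDE.SelfSimilar
import Literature.Analysis.FluidPDE.TypeIAncientMild
import Literature.Analysis.FluidPDE.DyadicChaining
import Summits.NavierStokesRegularity.NavierStokesRegularity.Theorems.QuarterLogPincerThinCascadeDefs
import Summits.NavierStokesRegularity.NavierStokesRegularity.Theorems.QuarterLogPincerTruncationEdgeDefs
import Summits.NavierStokesRegularity.NavierStokesRegularity.Theorems.QuarterLogPincerTruncationEdgeAnatomyDefs

/-!
# Crux `QuarterLogPincer.TypeIQuantSubcubicExp` (stmt-NavierStokesRegularity-24077), EDGE line `truncation_edge` (ns-idea-7 g8/g9):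
# **T1 FROM ITS ANATOMY, BY NAME** — `stubFarFieldTruncation_of_anatomy : StubCutoffData → StubFrameBootstrap → StubSupShadowing → StubExteriorCube → StubFarFieldTruncation`

Tree copy of the AUTHOR'S PROOF (ns-idea-7 g9, workfile `Cruxes/TypeIQuantSubcubicExp/Lines/truncation_edge.lean` v1.4, section
«T1 FROM ITS ANATOMY: the composition P1 → P2 → P3 → P4 → T1 (PROVED)», VERBATIM: `continuousOn_shift_of_contDiffOn_past`,
`farFieldTruncation_of_anatomy`, `stubFarFieldTruncation_of_anatomy`; the elementary `add_pow_three_le` is the tree's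
`DyadicChaining.add_pow_three_le_four`, as in C26's `…TruncationEdgeCore`), re-homed by the pub-ns-dss typer (g35;
`--supports stmt-NavierStokesRegularity-24077`, helper) over the re-homed objects (`…TruncationEdgeDefs` p660448, `…TruncationEdgeAnatomyDefs`
p669402).  With the landed by-name pieces (`…CutoffData` P1, `…FrameBootstrap` P2, `…SupShadowingCore` P3a, `…ProfileIntegration`
P3b′ ⇒ P3b, `…SupShadowingGlue` P3 = P3a ∘ P3b, `…ExteriorCube` P4) this puts `StubFarFieldTruncation` (T1, the one input of the edge
24077 ⇒ 22144) one `exact` away from the single open piece P3b′ `StubSupShadowingProfile` (`…TruncationEdgeT1OfProfile`).  Credit: ns-idea-7 g9.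

HONEST FRAME: composition of statements about hypothetical objects; P3b′, T1, 24077, 22144, W7 and NS regularity OPEN / not proved.
-/

noncomputable section

-- the summit-side namespace repeats a component by design (D-0017)
set_option linter.dupNamespace false

namespace Summit.NavierStokesRegularity.NavierStokesRegularity.Cruxes.TypeIQuantSubcubicExp.TruncationEdge

open MeasureTheory Set Function Metric Filter Topology
open scoped ENNReal NNReal
open Literature.Analysis Literature.Analysis.FluidPDE
open Summit.NavierStokesRegularity.NavierStokesRegularity.Cruxes.TypeIQuantSubcubicExp.ThinCascade

/-! ### The composition (author's v1.4 section, verbatim) -/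

/-- Slices `x ↦ v (t - 1) x`, `t ≤ 1 - ε`, of a field smooth on the open past are continuous, and the
shifted field is jointly continuous on `[0, 1-ε] × ℝ³`. [folklore] -/
theorem continuousOn_shift_of_contDiffOn_past
    {v : ℝ → EuclideanSpace ℝ (Fin 3) → EuclideanSpace ℝ (Fin 3)}
    (h : ContDiffOn ℝ (⊤ : ℕ∞) (uncurry v) (Iio 0 ×ˢ univ)) {T : ℝ} (hT : T < 1) :
    ContinuousOn (uncurry fun t x => v (t - 1) x) (Icc 0 T ×ˢ univ) := by
  have hc : ContinuousOn (uncurry v) (Iio 0 ×ˢ univ) := h.continuousOn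
  have hmap : MapsTo (fun q : ℝ × EuclideanSpace ℝ (Fin 3) => (q.1 - 1, q.2)) (Icc 0 T ×ˢ univ)
      (Iio 0 ×ˢ univ) := by
    intro q hq
    refine ⟨?_, mem_univ _⟩
    have : q.1 ≤ T := (mem_prod.1 hq).1.2
    show q.1 - 1 < 0
    linarith
  have hφ : Continuous (fun q : ℝ × EuclideanSpace ℝ (Fin 3) => (q.1 - 1, q.2)) := by fun_prop
  have := hc.comp hφ.continuousOn hmap
  exact this

set_option maxHeartbeats 400000 in
/-- **T1 from its anatomy (PROVED).**  Cut-off data (P1), the frame bootstrap (P2), sup shadowing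
with polynomial loss (P3) and the exterior cube (P4) give the finite-time far-field truncation
stability `FarFieldTruncation M v` of every enveloped Type-I ancient mild field — with comparison
radius `R = 2ρ`, `ρ = (K₃ + ρ₀ + 2K₁/δ + 1)·ε^{−κ}`, and a log-shaped `L³` excess. [this file; line theorem] -/
theorem farFieldTruncation_of_anatomy {M A : ℝ}
    {v : ℝ → EuclideanSpace ℝ (Fin 3) → EuclideanSpace ℝ (Fin 3)}
    (hA : 0 ≤ A) (hv : IsTypeIAncientMild M v) (hdec : HasTypeIDecay A v)
    (h1 : CutoffData v) (h2 : FrameBootstrap) (h3 : SupShadowing v) (h4 : ExteriorCube) :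
    FarFieldTruncation M v := by
  intro δ hδ hδ1
  -- P1: cut-off data with constant K₁
  obtain ⟨K₁, hK₁, hdata⟩ := h1
  -- P3: shadowing constants κ, K₃ for data accuracy K₁ and target accuracy δ
  obtain ⟨κ, K₃, hκ, hK₃, hshadow⟩ := h3 K₁ δ hK₁ hδ hδ1
  -- P4: exterior constants for sup bound A + K₃ + K₁ and energy constant K₁
  obtain ⟨ρ₀, K₄, hρ₀, hK₄, hext⟩ := h4 (A + K₃ + K₁) K₁ (by linarith) hK₁
  -- the rate constant is nonnegative
  have hM : 0 ≤ M := by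
    have h := hv.2.2.2 (-1) (by norm_num) 0
    rw [neg_neg, Real.sqrt_one, div_one] at h
    exact (norm_nonneg _).trans h
  -- constants of T1
  set c₀ : ℝ := K₃ + ρ₀ + 2 * K₁ / δ + 1 with hc₀
  have hc₀pos : 1 ≤ c₀ := by
    have : 0 ≤ 2 * K₁ / δ := by positivity
    linarith
  refine ⟨κ, max (2 * c₀) (8 * (K₃ + K₄) + 1), hκ,
    le_max_of_le_right (by linarith), ?_⟩
  intro ε hε
  have hεpos : 0 < ε := hε.1
  have hεhalf : ε ≤ 1 / 2 := hε.2
  have hεlt1 : ε < 1 := by linarith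
  -- ε^{-κ} ≥ 1
  have hεκ : 1 ≤ ε ^ (-κ) :=
    Real.one_le_rpow_of_pos_of_le_one_of_nonpos hεpos hεlt1.le (by linarith)
  -- the cut-off radius
  set ρ : ℝ := c₀ * ε ^ (-κ) with hρ
  have hρc₀ : c₀ ≤ ρ := by
    have := mul_le_mul_of_nonneg_left hεκ (by linarith : (0 : ℝ) ≤ c₀)
    simpa [hρ] using this
  have hρ1 : 1 ≤ ρ := hc₀pos.trans hρc₀
  have hρpos : 0 < ρ := by linarith
  have hρρ₀ : ρ₀ ≤ ρ := by
    have : ρ₀ ≤ c₀ := by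
      have : 0 ≤ 2 * K₁ / δ := by positivity
      linarith
    exact this.trans hρc₀
  have hρK₃ : K₃ * ε ^ (-κ) ≤ ρ := by
    have : K₃ ≤ c₀ := by
      have : 0 ≤ 2 * K₁ / δ := by positivity
      linarith
    exact mul_le_mul_of_nonneg_right this (by linarith)
  have hρδ : K₁ / ρ ≤ δ / 2 := by
    rw [div_le_iff₀ hρpos]
    have h1 : 2 * K₁ / δ ≤ ρ := by
      have : 2 * K₁ / δ ≤ c₀ := by linarith
      exact this.trans hρc₀
    have h2 : 2 * K₁ ≤ δ * ρ := by
      have := (div_le_iff₀ hδ).1 h1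
      linarith
    linarith
  -- P1 at ρ
  obtain ⟨u₀, hu₀s, hu₀d, hu₀c, hu₀t, hu₀v, hu₀E⟩ := hdata ρ hρ1
  -- the reference field V(t) = v(t-1) on [0, 1-ε]
  set T : ℝ := 1 - ε with hT
  have hTpos : 0 < T := by rw [hT]; linarith
  have hTlt : T < 1 := by rw [hT]; linarith
  set V : ℝ → EuclideanSpace ℝ (Fin 3) → EuclideanSpace ℝ (Fin 3) := fun t x => v (t - 1) x with hV
  have hVcont : ContinuousOn (uncurry V) (Icc 0 T ×ˢ univ) :=
    continuousOn_shift_of_contDiffOn_past hv.1 hTlt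
  -- envelope of V
  have hVenv : ∀ t ∈ Icc 0 T, ∀ x, ‖V t x‖ ≤ A / (‖x‖ + Real.sqrt (1 - t)) := by
    intro t ht x
    have h := hdec (t - 1) (by rw [hT] at ht; linarith [ht.2]) x
    have : -(t - 1) = 1 - t := by ring
    rw [this] at h
    exact h
  have hsqrt : ∀ t ∈ Icc 0 T, Real.sqrt ε ≤ Real.sqrt (1 - t) := by
    intro t ht
    apply Real.sqrt_le_sqrt
    rw [hT] at ht; linarith [ht.2]
  have hsqε : 0 < Real.sqrt ε := Real.sqrt_pos.2 hεpos
  have hVbd : ∃ B : ℝ, ∀ t ∈ Icc 0 T, ∀ x, ‖V t x‖ ≤ B := by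
    refine ⟨A / Real.sqrt ε, fun t ht x => (hVenv t ht x).trans ?_⟩
    have hden : Real.sqrt ε ≤ ‖x‖ + Real.sqrt (1 - t) := by
      have := hsqrt t ht
      linarith [norm_nonneg x]
    exact div_le_div_of_nonneg_left hA hsqε hden
  have hVdec : ∀ η : ℝ, 0 < η → ∃ R : ℝ, ∀ t ∈ Icc 0 T, ∀ x : EuclideanSpace ℝ (Fin 3),
      R ≤ ‖x‖ → ‖V t x‖ ≤ η := by
    intro η hη
    refine ⟨A / η + 1, fun t ht x hx => (hVenv t ht x).trans ?_⟩
    have hRpos : 0 < A / η + 1 := by positivity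
    have hxpos : 0 < ‖x‖ := lt_of_lt_of_le hRpos hx
    have hden : A / η + 1 ≤ ‖x‖ + Real.sqrt (1 - t) := by
      linarith [Real.sqrt_nonneg (1 - t)]
    calc A / (‖x‖ + Real.sqrt (1 - t)) ≤ A / (A / η + 1) :=
          div_le_div_of_nonneg_left hA hRpos hden
      _ ≤ η := by
          rw [div_le_iff₀ hRpos]
          have : η * (A / η + 1) = A + η := by field_simp
          rw [this]; linarith
  -- data closeness to V(0) = v(-1)
  have hclose0 : ∀ x, ‖u₀ x - V 0 x‖ ≤ δ / 2 := by
    intro x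
    have : V 0 x = v (-1) x := by simp [hV]
    rw [this]
    exact (hu₀v x).trans hρδ
  -- the improvement from P3(a)
  have himp : ∀ T' ∈ Ioc 0 T, ∀ (u : ℝ → EuclideanSpace ℝ (Fin 3) → EuclideanSpace ℝ (Fin 3))
      (p : ℝ → EuclideanSpace ℝ (Fin 3) → ℝ), TaoFrame T' u p → u 0 = u₀ →
      (∀ t ∈ Icc 0 T', ∀ x, ‖u t x - V t x‖ ≤ 2 * δ) →
      ∀ t ∈ Icc 0 T', ∀ x, ‖u t x - V t x‖ ≤ δ := by
    intro T' hT' u p hframe hu0 hboot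
    exact (hshadow ε hε ρ hρK₃ u₀ hu₀v T' hT' u p hframe hu0 hboot).1
  -- P2: the Tao-frame solution on [0, 1-ε]
  obtain ⟨u, p, hframe, hu0, hclose⟩ :=
    h2 T δ u₀ V hTpos hδ hu₀s hu₀d hu₀c hVcont hVbd hVdec hclose0 himp
  -- P3 on the full slab
  have hTmem : T ∈ Ioc 0 T := ⟨hTpos, le_rfl⟩
  have hboot : ∀ t ∈ Icc 0 T, ∀ x, ‖u t x - v (t - 1) x‖ ≤ 2 * δ := by
    intro t ht x
    have := hclose t ht x
    simp only [hV] at this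
    linarith
  obtain ⟨hclose', hout, k₃, hk₃, hk₃K, hL3in⟩ :=
    hshadow ε hε ρ hρK₃ u₀ hu₀v T hTmem u p hframe hu0 hboot
  -- sup bounds of the datum and of the solution outside B(ρ)
  have hv1 : ∀ x : EuclideanSpace ℝ (Fin 3), ‖v (-1) x‖ ≤ A / (‖x‖ + 1) := by
    intro x
    have h := hdec (-1) (by norm_num) x
    rw [neg_neg, Real.sqrt_one] at h
    exact h
  have hu₀sup : ∀ x, ‖u₀ x‖ ≤ A + K₃ + K₁ := by
    intro x
    have h1 : ‖u₀ x‖ ≤ ‖v (-1) x‖ + K₁ / ρ := by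
      calc ‖u₀ x‖ = ‖(u₀ x - v (-1) x) + v (-1) x‖ := by abel_nf
        _ ≤ ‖u₀ x - v (-1) x‖ + ‖v (-1) x‖ := norm_add_le _ _
        _ ≤ K₁ / ρ + ‖v (-1) x‖ := by linarith [hu₀v x]
        _ = ‖v (-1) x‖ + K₁ / ρ := by ring
    have h2 : ‖v (-1) x‖ ≤ A := by
      refine (hv1 x).trans ?_
      rw [div_le_iff₀ (by positivity)]
      nlinarith [norm_nonneg x]
    have h3 : K₁ / ρ ≤ K₁ := by
      rw [div_le_iff₀ hρpos]; nlinarith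
    have h4 : (0 : ℝ) ≤ K₃ := by linarith
    linarith
  have husup : ∀ t ∈ Icc 0 T, ∀ x : EuclideanSpace ℝ (Fin 3), ρ ≤ ‖x‖ →
      ‖u t x‖ ≤ (A + K₃ + K₁) / ρ := by
    intro t ht x hx
    have hxpos : 0 < ‖x‖ := lt_of_lt_of_le hρpos hx
    have h1 : ‖u t x‖ ≤ ‖v (t - 1) x‖ + K₃ / ρ := by
      calc ‖u t x‖ = ‖(u t x - v (t - 1) x) + v (t - 1) x‖ := by abel_nf
        _ ≤ ‖u t x - v (t - 1) x‖ + ‖v (t - 1) x‖ := norm_add_le _ _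
        _ ≤ K₃ / ρ + ‖v (t - 1) x‖ := by linarith [hout t ht x hx]
        _ = ‖v (t - 1) x‖ + K₃ / ρ := by ring
    have h2 : ‖v (t - 1) x‖ ≤ A / ρ := by
      have := hVenv t ht x
      simp only [hV] at this
      refine this.trans ?_
      exact div_le_div_of_nonneg_left hA hρpos (by linarith [Real.sqrt_nonneg (1 - t)])
    have h3 : A / ρ + K₃ / ρ ≤ (A + K₃ + K₁) / ρ := by
      rw [← add_div]
      exact div_le_div_of_nonneg_right (by linarith) hρpos.le
    linarith
  -- P4 on the full slab
  have hT1 : T ∈ Ioc (0 : ℝ) 1 := ⟨hTpos, hTlt.le⟩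
  obtain ⟨k₄, hk₄, hk₄K, hL3out⟩ :=
    hext ρ hρρ₀ u₀ hu₀s hu₀c hu₀t hu₀E hu₀sup T hT1 u p hframe hu0 husup
  -- assemble T1 at this ε with R = 2ρ, k = k₃ + k₄
  refine ⟨2 * ρ, u, p, by linarith, ?_, hframe, ?_, ⟨k₃ + k₄, by linarith, ?_, ?_⟩, ?_⟩
  · -- R ≤ K ε^{-κ}
    have : 2 * ρ = (2 * c₀) * ε ^ (-κ) := by rw [hρ]; ring
    rw [this]
    exact mul_le_mul_of_nonneg_right (le_max_left _ _) (by linarith)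
  · -- (i) the virtual Type-I bound with constant M + 1
    intro t ht x
    have ht' : t ∈ Icc 0 T := by simpa [hT] using ht
    have h1t : 0 < 1 - t := by rw [hT] at ht'; linarith [ht'.2]
    have h1t' : 1 - t ≤ 1 := by linarith [ht'.1]
    have hrate : ‖v (t - 1) x‖ ≤ M * (1 - t) ^ (-(1 / 2 : ℝ)) := by
      have h := hv.2.2.2 (t - 1) (by linarith) x
      have hneg : -(t - 1) = 1 - t := by ring
      rw [hneg, Real.sqrt_eq_rpow, div_eq_mul_inv, ← Real.rpow_neg h1t.le] at h
      exact h
    have hone : (1 : ℝ) ≤ (1 - t) ^ (-(1 / 2 : ℝ)) :=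
      Real.one_le_rpow_of_pos_of_le_one_of_nonpos h1t h1t' (by norm_num)
    have hw : ‖u t x - v (t - 1) x‖ ≤ δ := hclose' t ht' x
    have heq : (1 - ε + ε - t) = 1 - t := by ring
    rw [heq]
    calc ‖u t x‖ = ‖(u t x - v (t - 1) x) + v (t - 1) x‖ := by abel_nf
      _ ≤ ‖u t x - v (t - 1) x‖ + ‖v (t - 1) x‖ := norm_add_le _ _
      _ ≤ δ + M * (1 - t) ^ (-(1 / 2 : ℝ)) := by linarith
      _ ≤ 1 * (1 - t) ^ (-(1 / 2 : ℝ)) + M * (1 - t) ^ (-(1 / 2 : ℝ)) := by nlinarith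
      _ = (M + 1) * (1 - t) ^ (-(1 / 2 : ℝ)) := by ring
  · -- (ii) the cube-log shape of the excess
    have hlogρ : 0 ≤ Real.log ρ := Real.log_nonneg hρ1
    have hlogR : Real.log ρ ≤ Real.log (2 * ρ) := Real.log_le_log hρpos (by linarith)
    have hlogε : 0 ≤ Real.log (1 / ε) := by
      apply Real.log_nonneg; rw [le_div_iff₀ hεpos]; linarith
    have h1 : (k₃ + k₄) ^ 3 ≤ 4 * k₃ ^ 3 + 4 * k₄ ^ 3 := DyadicChaining.add_pow_three_le_four hk₃ hk₄
    have h2 : 4 * k₃ ^ 3 + 4 * k₄ ^ 3 ≤ (8 * (K₃ + K₄) + 1) * (1 + Real.log ρ) := by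
      have hK₃' : 0 ≤ K₃ := by linarith
      nlinarith
    have h3 : (8 * (K₃ + K₄) + 1) * (1 + Real.log ρ) ≤
        max (2 * c₀) (8 * (K₃ + K₄) + 1) * (1 + Real.log (2 * ρ) + Real.log (1 / ε)) := by
      have ha : (8 * (K₃ + K₄) + 1) ≤ max (2 * c₀) (8 * (K₃ + K₄) + 1) := le_max_right _ _
      have hb : (1 + Real.log ρ) ≤ (1 + Real.log (2 * ρ) + Real.log (1 / ε)) := by linarith
      have hK' : 0 ≤ 8 * (K₃ + K₄) + 1 := by
        have : (0 : ℝ) ≤ K₃ := by linarith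
        linarith
      exact mul_le_mul ha hb (by linarith) ((hK').trans ha)
    linarith
  · -- (ii) the L³ bound: ‖u t‖₃ ≤ b + k₃ + k₄
    intro b hb hbv t ht
    have ht' : t ∈ Icc 0 T := by simpa [hT] using ht
    set B : Set (EuclideanSpace ℝ (Fin 3)) := Metric.closedBall 0 (2 * ρ) with hB
    have hBm : MeasurableSet B := Metric.isClosed_closedBall.measurableSet
    -- measurability of the slices
    have hucont : Continuous (u t) :=
      (hframe.1.contDiff_velocity (by simpa [hT] using ht)).continuous
    have hvcont : Continuous (fun x => v (t - 1) x) := by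
      have hc := hVcont.comp_continuous (f := fun x : EuclideanSpace ℝ (Fin 3) => (t, x))
        (by fun_prop) (fun x => ⟨ht', mem_univ _⟩)
      exact hc
    have hwcont : Continuous (fun x => u t x - v (t - 1) x) := hucont.sub hvcont
    have hu_ae : AEStronglyMeasurable (u t) volume := hucont.aestronglyMeasurable
    -- u t = 1_B (v(t-1)) + 1_B (u t - v(t-1)) + 1_{Bᶜ} (u t)
    have hsplit : u t = (B.indicator (fun x => v (t - 1) x) +
        B.indicator (fun x => u t x - v (t - 1) x)) + Bᶜ.indicator (u t) := by
      have h1 : B.indicator (fun x => v (t - 1) x) + B.indicator (fun x => u t x - v (t - 1) x) =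
          B.indicator (u t) := by
        rw [← Set.indicator_add']
        congr 1
        funext x
        simp
      rw [h1, Set.indicator_self_add_compl]
    have hm1 : AEStronglyMeasurable (B.indicator (fun x => v (t - 1) x)) volume :=
      hvcont.aestronglyMeasurable.indicator hBm
    have hm2 : AEStronglyMeasurable (B.indicator (fun x => u t x - v (t - 1) x)) volume :=
      hwcont.aestronglyMeasurable.indicator hBm
    have hm3 : AEStronglyMeasurable (Bᶜ.indicator (u t)) volume := hu_ae.indicator hBm.compl
    have h3 : (1 : ℝ≥0∞) ≤ 3 := by norm_num
    -- the localised slice of v on the OPEN ball of radius R = 2ρ bounds the closed-ball one a.e.;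
    -- we simply use B ⊆ ball 0 R? No: closedBall ⊄ ball. Use instead the hypothesis on ball (2ρ)
    -- via monotonicity closedBall 0 (2ρ) \ ball 0 (2ρ) = sphere, a null set.
    have hvB : eLpNorm (B.indicator (fun x => v (t - 1) x)) 3 volume ≤ ENNReal.ofReal b := by
      have hs : t - 1 ∈ Icc (-1 : ℝ) (-ε) := by
        rw [hT] at ht'; constructor <;> linarith [ht'.1, ht'.2]
      have hball := hbv (t - 1) hs
      -- indicator of closedBall equals indicator of ball a.e. (the sphere is null)
      have hae : B.indicator (fun x => v (t - 1) x) =ᵐ[volume]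
          (Metric.ball (0 : EuclideanSpace ℝ (Fin 3)) (2 * ρ)).indicator (v (t - 1)) := by
        have hnull : volume (Metric.sphere (0 : EuclideanSpace ℝ (Fin 3)) (2 * ρ)) = 0 :=
          Measure.addHaar_sphere volume 0 (2 * ρ)
        have hsub : {x | B.indicator (fun x => v (t - 1) x) x ≠
            (Metric.ball (0 : EuclideanSpace ℝ (Fin 3)) (2 * ρ)).indicator (v (t - 1)) x} ⊆
            Metric.sphere (0 : EuclideanSpace ℝ (Fin 3)) (2 * ρ) := by
          intro x hx
          by_contra hxs
          apply hx
          by_cases hxb : x ∈ Metric.ball (0 : EuclideanSpace ℝ (Fin 3)) (2 * ρ)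
          · have hxB : x ∈ B := Metric.ball_subset_closedBall hxb
            simp [Set.indicator_of_mem hxB, Set.indicator_of_mem hxb]
          · have hxB : x ∉ B := by
              intro hxB
              apply hxs
              rw [Metric.mem_sphere]
              have h1 : dist x 0 ≤ 2 * ρ := Metric.mem_closedBall.1 hxB
              have h2 : 2 * ρ ≤ dist x 0 := not_lt.1 fun h => hxb (Metric.mem_ball.2 h)
              linarith
            simp [Set.indicator_of_notMem hxB, Set.indicator_of_notMem hxb]
        exact measure_mono_null hsub hnull
      rw [eLpNorm_congr_ae hae]
      exact hball
    have hk₃t : eLpNorm (B.indicator (fun x => u t x - v (t - 1) x)) 3 volume ≤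
        ENNReal.ofReal k₃ := hL3in t ht'
    have hk₄t : eLpNorm (Bᶜ.indicator (u t)) 3 volume ≤ ENNReal.ofReal k₄ := hL3out t ht'
    have step1 : eLpNorm ((B.indicator (fun x => v (t - 1) x) +
          B.indicator (fun x => u t x - v (t - 1) x)) + Bᶜ.indicator (u t)) 3 volume ≤
        eLpNorm (B.indicator (fun x => v (t - 1) x) +
            B.indicator (fun x => u t x - v (t - 1) x)) 3 volume +
          eLpNorm (Bᶜ.indicator (u t)) 3 volume := eLpNorm_add_le (hm1.add hm2) hm3 h3
    have step2 : eLpNorm (B.indicator (fun x => v (t - 1) x) +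
          B.indicator (fun x => u t x - v (t - 1) x)) 3 volume ≤
        eLpNorm (B.indicator (fun x => v (t - 1) x)) 3 volume +
          eLpNorm (B.indicator (fun x => u t x - v (t - 1) x)) 3 volume :=
      eLpNorm_add_le hm1 hm2 h3
    have hsum : eLpNorm (B.indicator (fun x => v (t - 1) x) +
            B.indicator (fun x => u t x - v (t - 1) x)) 3 volume +
          eLpNorm (Bᶜ.indicator (u t)) 3 volume ≤
        (ENNReal.ofReal b + ENNReal.ofReal k₃) + ENNReal.ofReal k₄ :=
      add_le_add (step2.trans (add_le_add hvB hk₃t)) hk₄t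
    have hfin : (ENNReal.ofReal b + ENNReal.ofReal k₃) + ENNReal.ofReal k₄ =
        ENNReal.ofReal (b + (k₃ + k₄)) := by
      rw [← ENNReal.ofReal_add hb hk₃, ← ENNReal.ofReal_add (by linarith) hk₄]
      congr 1
      ring
    rw [hsplit]
    exact (step1.trans hsum).trans hfin.le
  · -- (iii) δ-closeness on the unit ball at the final time
    intro x _
    have hTmem' : T ∈ Icc 0 T := ⟨hTpos.le, le_rfl⟩
    have h := hclose' T hTmem' x
    have : T - 1 = -ε := by rw [hT]; ring
    rw [this] at h
    simpa [hT] using h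

/-- **T1 from the four registered pieces (PROVED).** [this file; line theorem] -/
theorem stubFarFieldTruncation_of_anatomy (h1 : StubCutoffData) (h2 : StubFrameBootstrap)
    (h3 : StubSupShadowing) (h4 : StubExteriorCube) : StubFarFieldTruncation := by
  intro M A v hv hdec
  have hA : 0 ≤ A := by
    have h := hdec (-1) (by norm_num) 0
    rw [neg_neg, Real.sqrt_one, norm_zero, zero_add, div_one] at h
    exact (norm_nonneg _).trans h
  exact farFieldTruncation_of_anatomy hA hv hdec (h1 M A v hA hv hdec) h2 (h3 M A v hv hdec) h4

end Summit.NavierStokesRegularity.NavierStokesRegularity.Cruxes.TypeIQuantSubcubicExp.TruncationEdge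

end
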